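import Summits.RiemannHypothesis.RiemannHypothesis.Theorems.GroundBartaEvenWinsBeyondArchDeflationMajorant
import Summits.RiemannHypothesis.RiemannHypothesis.Theorems.WeilGroundStateGroundStateSimpleEvenIncrementSplit
import Summits.RiemannHypothesis.RiemannHypothesis.Theorems.WeilWindowFlowWindowLipschitzStubSupBoundAux
import HarnessLib

/-!
# RiemannHypothesis / GroundBarta — rung 4 (`EvenWinsBeyondArch`, stmt-RiemannHypothesis-18807):
# the deflated Temple (Lehmann–Maehly) L-side programme, VIII — `C¹ × indicator` trial vectors have finite energy

Helper file (`--supports stmt-RiemannHypothesis-18807`), RH-free, Mathlib + landed tree files only, no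
definitions, no named facts.

The deflated Temple bound asks its trial vectors to lie in the FORM DOMAIN of the window: `L²`, zero off
`[-c, c]`, and finite archimedean energy `∫₀^∞ ρ(t) D_t(v) dt < ∞`.  For the trial vectors of the certificates,
`v = g · 𝟙_{[-c,c]}` with `g ∈ C¹(ℝ)` (polynomial × indicator), `dt_finiteEnergy_indicator_mul` proves the last
property: by the increment split of the tree (`GroundStateSimpleEven.incs_weilIncrement_of_le/_of_ge`),
`D_t(v) = ∫_{-c}^{-c+t} g² + ∫_{c-t}^{c} g² + ∫_{-c}^{c-t} (g(x+t) − g(x))² ≤ 2‖g‖²_∞ t + 2c‖g'‖²_∞ t²` for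
`t ≤ 2c` (the jump at the edges costs `O(t)`, which the density `ρ(t) ≤ 1/(2t) + 1/4` absorbs) and
`D_t(v) = 2‖v‖²` beyond.  Prover B, speedrun unit `sr-gb-rung-b` (gen 3).

References: E. Bombieri, Rend. Mat. Acc. Lincei (9) 11 (2000) 183–233, Thm 2; M. Fukushima, Y. Oshima,
M. Takeda, *Dirichlet Forms and Symmetric Markov Processes* (2011) Ex. 1.4.1.
-/

set_option linter.dupNamespace false

noncomputable section

open MeasureTheory Set Filter
open scoped Topology ENNReal NNReal

namespace Summit.RiemannHypothesis.RiemannHypothesis.Theorems.EvenWinsBeyondArch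

open Literature.NumberTheory.LFunctions
open Summit.RiemannHypothesis.RiemannHypothesis.Theorems.GroundStateSimpleEven
  (incs_weilIncrement_of_le incs_weilIncrement_of_ge incs_memLp)
open Summit.RiemannHypothesis.RiemannHypothesis.Theorems.WeilWindowFlowWindowLipschitz
  (stub_supBound_aesm_weilIncrement)
open Summit.RiemannHypothesis.RiemannHypothesis.Theorems.WeilParity.EvenWinsArch (mul_weilArchDensity_le)

/-- **Lipschitz bound from a derivative bound on the window**: if `g ∈ C¹` and `|g'| ≤ G₁` on `[-c, c]` then
`|g(x + t) − g(x)| ≤ G₁ t` whenever `x, x + t ∈ [-c, c]`, `t ≥ 0`. -/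
theorem dt_sub_le_of_deriv_le {g : ℝ → ℝ} (hg : ContDiff ℝ 1 g) {c G₁ x t : ℝ} (ht : 0 ≤ t)
    (hG₁ : ∀ s ∈ Icc (-c) c, ‖deriv g s‖ ≤ G₁) (hx : x ∈ Icc (-c) c) (hxt : x + t ∈ Icc (-c) c) :
    ‖g (x + t) - g x‖ ≤ G₁ * t := by
  have hd : Differentiable ℝ g := hg.differentiable (by norm_num)
  have h := Convex.norm_image_sub_le_of_norm_hasDerivWithin_le (f := g) (f' := deriv g)
    (fun s _ ↦ (hd s).hasDerivAt.hasDerivWithinAt) hG₁ (convex_Icc (-c) c) hx hxt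
  rwa [add_sub_cancel_left, Real.norm_of_nonneg ht] at h

/-- **`C¹ × indicator` trial vectors have finite archimedean energy**: for `c > 0` and `g ∈ C¹(ℝ)`,
`t ↦ ρ(t) D_t(g 𝟙_{[-c,c]})` is integrable on `(0, ∞)`. -/
theorem dt_finiteEnergy_indicator_mul {c : ℝ} (hc : 0 < c) {g : ℝ → ℝ} (hg : ContDiff ℝ 1 g) :
    IntegrableOn (fun t ↦ weilArchDensity t *
      weilIncrement (fun x : ℝ ↦ (((Icc (-c) c).indicator g x : ℝ) : ℂ)) t) (Ioi 0) := by
  have hgc : Continuous g := hg.continuous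
  -- bounds for `g` and `g'` on the window
  obtain ⟨G₀, hG₀⟩ := isCompact_Icc.exists_bound_of_continuousOn (hgc.continuousOn : ContinuousOn g (Icc (-c) c))
  obtain ⟨G₁, hG₁⟩ := isCompact_Icc.exists_bound_of_continuousOn
    ((hg.continuous_deriv le_rfl).continuousOn : ContinuousOn (deriv g) (Icc (-c) c))
  have hG₀0 : 0 ≤ G₀ := (norm_nonneg _).trans (hG₀ 0 ⟨by linarith, by linarith⟩)
  have hG₁0 : 0 ≤ G₁ := (norm_nonneg _).trans (hG₁ 0 ⟨by linarith, by linarith⟩)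
  set v : ℝ → ℂ := fun x : ℝ ↦ (((Icc (-c) c).indicator g x : ℝ) : ℂ) with hv
  set N : ℝ := ∫ x in (-c)..c, g x ^ 2 with hN
  -- the increments: `D_t ≤ 2 G₀² t + 2c G₁² t²` for `0 < t ≤ 2c`, `D_t = 2N` beyond
  have hsq_le : ∀ a b : ℝ, -c ≤ a → a ≤ b → b ≤ c → ∫ x in a..b, g x ^ 2 ≤ G₀ ^ 2 * (b - a) := by
    intro a b ha hab hb
    have h := intervalIntegral.norm_integral_le_of_norm_le_const (a := a) (b := b) (C := G₀ ^ 2)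
      (f := fun x ↦ g x ^ 2) fun x hx ↦ by
        rw [uIoc_of_le hab] at hx
        have hxI : x ∈ Icc (-c) c := ⟨by linarith [hx.1], by linarith [hx.2]⟩
        rw [Real.norm_eq_abs, abs_of_nonneg (sq_nonneg _), ← sq_abs, ← Real.norm_eq_abs]
        exact pow_le_pow_left₀ (norm_nonneg _) (hG₀ x hxI) 2
    rw [abs_of_nonneg (by linarith)] at h
    exact (le_abs_self _).trans ((Real.norm_eq_abs _).symm.le.trans h)
  have hD_small : ∀ t, 0 < t → t ≤ 2 * c →
      weilIncrement v t ≤ 2 * G₀ ^ 2 * t + 2 * c * G₁ ^ 2 * t ^ 2 := by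
    intro t ht htc
    rw [hv, incs_weilIncrement_of_le hgc hc ht.le htc]
    have h1 := hsq_le (-c) (-c + t) le_rfl (by linarith) (by linarith)
    have h2 := hsq_le (c - t) c (by linarith) (by linarith) le_rfl
    have h3 : ∫ x in (-c)..(c - t), (g (x + t) - g x) ^ 2 ≤ (G₁ * t) ^ 2 * (c - t - -c) := by
      have h := intervalIntegral.norm_integral_le_of_norm_le_const (a := -c) (b := c - t) (C := (G₁ * t) ^ 2)
        (f := fun x ↦ (g (x + t) - g x) ^ 2) fun x hx ↦ by
          rw [uIoc_of_le (by linarith)] at hx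
          have hxI : x ∈ Icc (-c) c := ⟨by linarith [hx.1], by linarith [hx.2]⟩
          have hxtI : x + t ∈ Icc (-c) c := ⟨by linarith [hx.1], by linarith [hx.2]⟩
          rw [Real.norm_eq_abs, abs_of_nonneg (sq_nonneg _), ← sq_abs, ← Real.norm_eq_abs]
          exact pow_le_pow_left₀ (norm_nonneg _) (dt_sub_le_of_deriv_le hg ht.le hG₁ hxI hxtI) 2
      rw [abs_of_nonneg (by linarith)] at h
      exact (le_abs_self _).trans ((Real.norm_eq_abs _).symm.le.trans h)
    have h4 : (G₁ * t) ^ 2 * (c - t - -c) ≤ 2 * c * G₁ ^ 2 * t ^ 2 := by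
      have : (c - t - -c) ≤ 2 * c := by linarith
      nlinarith [sq_nonneg (G₁ * t)]
    nlinarith [h1, h2, h3, h4]
  have hD_large : ∀ t, 2 * c ≤ t → weilIncrement v t = 2 * N := fun t ht ↦ by
    rw [hv, incs_weilIncrement_of_ge hgc hc ht]
  have hN0 : 0 ≤ N := by
    have := hD_large (2 * c) le_rfl
    linarith [weilIncrement_nonneg v (2 * c)]
  -- a dominating function
  set K : ℝ := G₀ ^ 2 + (c * G₁ ^ 2 + G₀ ^ 2 / 2) * (2 * c) + (c * G₁ ^ 2 / 2) * ((2 * c) * (2 * c)) with hK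
  have hK0 : 0 ≤ K := by positivity
  set H : ℝ → ℝ := fun t ↦ (Ioc 0 (2 * c)).indicator (fun _ ↦ K) t +
    (Ici (2 * c)).indicator (fun t ↦ 2 * N * weilArchDensity t) t with hH
  have hvol : volume (Ioc (0 : ℝ) (2 * c)) ≠ ⊤ := by rw [Real.volume_Ioc]; exact ENNReal.ofReal_ne_top
  have iK : IntegrableOn (fun _ : ℝ ↦ K) (Ioc 0 (2 * c)) := integrableOn_const hvol
  have iR : IntegrableOn (fun t ↦ 2 * N * weilArchDensity t) (Ici (2 * c)) :=
    (dt_integrableOn_weilArchDensity_Ici (by positivity)).const_mul _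
  have hHint : IntegrableOn H (Ioi 0) :=
    ((iK.integrable_indicator measurableSet_Ioc).integrableOn).add
      ((iR.integrable_indicator measurableSet_Ici).integrableOn)
  have hdom : ∀ t ∈ Ioi (0 : ℝ), weilArchDensity t * weilIncrement v t ≤ H t := by
    intro t (ht : 0 < t)
    have hρ := (weilArchDensity_pos ht).le
    have hI1 : 0 ≤ (Ioc 0 (2 * c)).indicator (fun _ ↦ K) t := by
      by_cases h : t ∈ Ioc 0 (2 * c)
      · rw [indicator_of_mem h]; exact hK0
      · rw [indicator_of_notMem h]
    have hI2 : 0 ≤ (Ici (2 * c)).indicator (fun t ↦ 2 * N * weilArchDensity t) t := by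
      by_cases h : t ∈ Ici (2 * c)
      · rw [indicator_of_mem h]; exact mul_nonneg (by positivity) hρ
      · rw [indicator_of_notMem h]
    by_cases htc : t ≤ 2 * c
    · have h1 : weilArchDensity t * weilIncrement v t ≤ K := by
        calc weilArchDensity t * weilIncrement v t
            ≤ weilArchDensity t * (2 * G₀ ^ 2 * t + 2 * c * G₁ ^ 2 * t ^ 2) :=
              mul_le_mul_of_nonneg_left (hD_small t ht htc) hρ
          _ = (t * weilArchDensity t) * (2 * G₀ ^ 2 + 2 * c * G₁ ^ 2 * t) := by ring
          _ ≤ (1 / 2 + t / 4) * (2 * G₀ ^ 2 + 2 * c * G₁ ^ 2 * t) :=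
              mul_le_mul_of_nonneg_right (mul_weilArchDensity_le ht) (by positivity)
          _ = G₀ ^ 2 + (c * G₁ ^ 2 + G₀ ^ 2 / 2) * t + (c * G₁ ^ 2 / 2) * (t * t) := by ring
          _ ≤ K := by
              rw [hK]
              have h_tt : t * t ≤ (2 * c) * (2 * c) := mul_le_mul htc htc ht.le (by positivity)
              have hA : (c * G₁ ^ 2 + G₀ ^ 2 / 2) * t ≤ (c * G₁ ^ 2 + G₀ ^ 2 / 2) * (2 * c) :=
                mul_le_mul_of_nonneg_left htc (by positivity)
              have hB : (c * G₁ ^ 2 / 2) * (t * t) ≤ (c * G₁ ^ 2 / 2) * ((2 * c) * (2 * c)) :=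
                mul_le_mul_of_nonneg_left h_tt (by positivity)
              linarith
      have h2 : K ≤ H t := by
        rw [hH]; simp only [indicator_of_mem (show t ∈ Ioc 0 (2 * c) from ⟨ht, htc⟩)]; linarith
      exact h1.trans h2
    · have htc' : 2 * c ≤ t := (not_le.1 htc).le
      have h1 : weilArchDensity t * weilIncrement v t = 2 * N * weilArchDensity t := by
        rw [hD_large t htc']; ring
      have h2 : 2 * N * weilArchDensity t ≤ H t := by
        rw [hH]; simp only [indicator_of_mem (show t ∈ Ici (2 * c) from htc')]; linarith
      exact h1.le.trans h2
  have hmeas : AEStronglyMeasurable (fun t ↦ weilArchDensity t * weilIncrement v t) (volume.restrict (Ioi 0)) :=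
    (measurable_weilArchDensity.aestronglyMeasurable.mul
      (stub_supBound_aesm_weilIncrement (incs_memLp hgc c).1)).restrict
  exact Integrable.mono' hHint hmeas ((ae_restrict_iff' measurableSet_Ioi).2 (Eventually.of_forall
    fun t ht ↦ by
      rw [Real.norm_of_nonneg (mul_nonneg (weilArchDensity_pos ht).le (weilIncrement_nonneg _ _))]
      exact hdom t ht))

/-- **`C¹ × indicator` trial vectors lie in the form domain of the window**: `L²`, zero off `[-c, c]`,
real-valued, finite archimedean energy. -/
theorem dt_indicator_mul_mem_formDomain {c : ℝ} (hc : 0 < c) {g : ℝ → ℝ} (hg : ContDiff ℝ 1 g) :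
    MemLp (fun x : ℝ ↦ (((Icc (-c) c).indicator g x : ℝ) : ℂ)) 2 ∧
    (∀ x, x ∉ Icc (-c) c → (fun x : ℝ ↦ (((Icc (-c) c).indicator g x : ℝ) : ℂ)) x = 0) ∧
    (∀ x, ((fun x : ℝ ↦ (((Icc (-c) c).indicator g x : ℝ) : ℂ)) x).im = 0) ∧
    IntegrableOn (fun t ↦ weilArchDensity t *
      weilIncrement (fun x : ℝ ↦ (((Icc (-c) c).indicator g x : ℝ) : ℂ)) t) (Ioi 0) :=
  ⟨incs_memLp hg.continuous c, fun x hx ↦ by simp [indicator_of_notMem hx],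
    fun x ↦ Complex.ofReal_im _, dt_finiteEnergy_indicator_mul hc hg⟩

end Summit.RiemannHypothesis.RiemannHypothesis.Theorems.EvenWinsBeyondArch

end
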